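import Mathlib

/-!
# STUB-IDEAS k3 (gen 37) — «GAUSS = TWIST»: the exact constant of R197a′ is a UNIT in the
# `g`-gauge, on all six keys; decomposition of the value identity at `v` into four kernel
# sub-stubs + one print residue, with the glue PROVED

Stub `stub_heegnerIndexLowerAtTwo` (LEAD skeleton `f2bd84c029a8a938`), crux
`PrintCf2.SplitBadTwoLowerHalfOfFacts` (stmt-BirchSwinnertonDyer-27851).  Technique (payload):
«decomposition (split into sub-stubs with a provable glue)».  Node: STUB-PLAN v6.9 HARDEST (b) =
R197a′ ⊕ R199 / R200′(b′) — «the exact constant `c(key) = ∫ρ_v dC_v` … the VALUE identity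
`∫ρ dμ_u = c·Σρ⁻¹(σ) log σu ⊗ℚ₂` in K2's consumed form + the column homes (R199; R200′(b′) at level
`n(key)`, pairing of record)».

THE LEVER.  The classical Gauss sum of the inertia type `θ_e ∈ {χ₋₄, χ₈, χ₋₈}` of the six keys IS
twice a square root of the key:  `g(χ₋₄) = 2i`, `g(χ₈) = 2√2`, `g(χ₋₈) = 2i√2`
(Fröhlich–Taylor 1991 (3.5.a–c), Thm 49 `τ(λ)² = d_K`), i.e. `g(θ_e) = η·2√u` with `η = ±1` on the
three `c = 0` keys `u ∈ {−1, 2, −2}` and `η = ±1/√−3 ∈ 𝕎(𝔽₄)ˣ` on their `c = 1` partners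
`u ∈ {3, −6, 6}` (`u = u₀·(−3)^c`).  Hence de Shalit's data↔measure constant of II.4.8 (19)/(21),
`τ_dS(θ_e) = 2^{−e}·g(θ_e)` (B45), and the route's gauge `g_u = log₂/(2√u)` (R206/B48:
`Lg_u = w·log₂/√u = (2w)·g_u`, `log₂ S_n = 2√u·AS_n`) PAIR EXACTLY:
`υ_key := τ_dS(θ_e)·(2√u) = η·u·2^{2−e}`, `υ_key² = (−3)^{c(key)}`, `υ_key ∈ {±1, ±(1+2ζ₃)} ⊂ ℤ₂[ζ₃]ˣ`.
With the Δ-collapse of the resolvent (`Res_{φ⊗χ_u} = Res_φ ∘ (1 − σ)`, integral, B61), the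
`ℤ₂[G_m]`-linearity of `Res_φ` through the (S-Y) generator `θ` (`Res_φ(λ·θ_m) = φ̂(λ)·Res_φ(θ_m)`) and
the UNIT RESOLVENT BY CONGRUENCE (`Res_φ(θ_m) ≡ Tr θ_m = θ₀ ∈ ℤ₂ˣ (mod ζ − 1)`, so a unit — B46's
«resolvent placement» carries no digit anywhere), de Shalit's level-`(e, m)` interpolation at `k = 0`
reads, for every finite-order `φ` of the unramified direction,
  `∫ φχ_u dμ_β⁰ = υ_key · Res_φ(θ_m) · ev_φ(coord_θ g_u(y_β))`,  `y_β := (N_{𝓛_m/L_m} β_m^{σ_𝔮})^{1−σ} ∈ S_m`,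
with `υ_key·Res_φ(θ_m)` a UNIT: the measure value and the `g`-coordinate value have THE SAME
valuation at every `φ` (K2's currency), the `L`-value is exactly `2·unit` times either
(`L = (2w)·g`, the located `2` of B48/row 85), and by separation (tree `IntSeriesIdentityPrinciple`,
k3-g29 `CharactersSeparate`, k1-g35 `Separates`) the same identity holds at the out-of-range
`ρ_v = ρ^{ur}·χ_u` with the unit `υ_key·ρ^{ur}(Θ)`, `Θ = (Σ_g g(θ_m) g⁻¹)_m ∈ 𝒪̂⟦Γ⟧ˣ`.
R200′(b′) answered: the torsion average `2^{−e}` (R2) and the Gauss numerator `g(θ_e)` are absorbed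
TOGETHER by the gauge's `2√u` — because `g(θ_e) = 2η√u` is an identity of algebraic integers, not a
coincidence of valuations; (R1)/(R3)/(R4)/(R5) stay on the value leg ((5)₂), untouched.

CONTENTS (all PROVED, `import Mathlib` only, no `sorry`, no `instance`, no `axiom`):
* §1 (S2) resolvents: `res`, `res_act` (equivariance), `res_linear_combination` ((S-Y)-linearity),
  `res_prod_collapse` + `sum_pair_char_neg` (Δ-collapse `Res_{φ⊗χ}(x) = Res_φ(x − σx)`),
  `res_inflate` (coherence of `φ ↦ Res_φ(θ_{m(φ)})` along the tower = trace-coherence of `θ`).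
* §2 (S3) unit resolvent by congruence: `sub_one_mem_jacobson_of_pow_two_pow_eq_one`
  (`ζ^{2^k} = 1`, residue characteristic `2` ⟹ `ζ − 1 ∈ J`), `isUnit_charSum_of_sub_one_mem_jacobson`,
  `isUnit_res_values` (the resolvent of a trace-unit element at any character of a `2`-group is a
  unit), `isUnit_map_of_isUnit_constantCoeff` (series form: `Θ ∈ A⟦T⟧` with unit augmentation is a
  unit, hence so is every value — the out-of-range `ρ^{ur}(Θ)`).
* §3 (S4) GAUSS = TWIST: `gauss4_eq/_sq`, `gauss8_eq/_sq`, `gauss8'_eq/_sq` (ring identities from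
  `ζ² = −1` / `ζ⁴ = −1`; tables = Mathlib `ZMod.χ₄/χ₈/χ₈'`, `chi*_table`), the key table `keys`
  (`u = u₀(−3)^c`, `u₀² ·16 = 4^e`: `decide`), `exactConstant_sq` (`(2^{−e} g · 2√u)² = (−3)^c`),
  `neg_three_eq_sq` (`−3 = (1 + 2ζ₃)²`), `exactConstant_mem` (`υ ∈ {±1, ±(1+2ζ₃)}`),
  `valuation_exactConstant` (`v(υ) = 1` for any valuation with `v(3) = 1`).
* §4 GLUE: `LocalValueTables` (the value tables at `v` indexed by the finite-order characters) with the
  sub-stubs as hypotheses `S1`–`S4`; `value_identity` (exact constant), `consumed_form_g`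
  (`v(∫φχ_u dμ_β⁰) = v(ev_φ coord g(y))`), `consumed_form_L` (`v(ev_φ L(y)) = v(2)·v(∫φχ_u dμ_β⁰)`),
  `transport_of_separates` + `isUnit_transport_constant` (out-of-range `ρ_v` by separation).

NOT proved here (print / other cards, named in the line card): S1 = de Shalit II.4.8 (21) at `k = 0`,
`𝔭 := v`, `n = e(key)`, `p = 2` (proof = (22) + orthogonality, `p`-parity-free; = II.5.2 (3) at the
single level `e`: k1-g35's residue, row 95 (4)); the semi-local Shapiro sum over `w ∣ v` (R216,
k3-g36); TABLE `μ_𝔞 = 12(σ_𝔞 − N𝔞)·μ(𝔣)` (II.5.2 (4), row 84) and B50's attribution; (S-Y) itself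
(consumed: `θ`, `coord`).  BSD is NOT proved by any of this; neither the crux nor the stub nor (2)₂ is.
-/

set_option autoImplicit false

namespace Summit.BirchSwinnertonDyer.BirchSwinnertonDyer.Cruxes.SplitBadTwoLowerHalfOfFacts.GaussTwistK3G37

open Finset

/-! ## §1 (S2) Resolvents: equivariance, (S-Y)-linearity, Δ-collapse, coherence along the tower -/

section Resolvent

variable {A : Type*} [CommRing A]
variable {N : Type*} [AddCommGroup N] [Module A N]
variable {G : Type*} [CommGroup G] [Fintype G]

/-- The resolvent `Res_φ = Σ_g φ(g⁻¹)·g` as an `A`-linear endomorphism of the carrier `N`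
(model: `A = 𝒪̂ ⊇ 𝕎(𝔽̄₂)[values]`, `N = 𝒪̂ ⊗_{ℤ₂} 𝒪_{F_m}` or `𝒪̂ ⊗ log U¹(𝓛_m)`, `G = Gal(F_m/ℚ₂)`
acting on the right factor, `φ : G → 𝒪̂` a character). -/
noncomputable def res (act : G →* (N →ₗ[A] N)) (φ : G →* A) : N →ₗ[A] N :=
  ∑ g : G, φ g⁻¹ • act g

theorem res_apply (act : G →* (N →ₗ[A] N)) (φ : G →* A) (x : N) :
    res act φ x = ∑ g : G, φ g⁻¹ • act g x := by
  simp [res, LinearMap.sum_apply, LinearMap.smul_apply]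

/-- Equivariance: `Res_φ(h·x) = φ(h)·Res_φ(x)`. -/
theorem res_act (act : G →* (N →ₗ[A] N)) (φ : G →* A) (h : G) (x : N) :
    res act φ (act h x) = φ h • res act φ x := by
  rw [res_apply, res_apply, Finset.smul_sum, ← Equiv.sum_comp (Equiv.mulRight h⁻¹)]
  refine Finset.sum_congr rfl (fun g _ => ?_)
  simp only [Equiv.coe_mulRight]
  have h1 : act (g * h⁻¹) (act h x) = act g x := by
    rw [← Module.End.mul_apply, ← map_mul, inv_mul_cancel_right]
  have h2 : φ (g * h⁻¹)⁻¹ = φ h * φ g⁻¹ := by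
    rw [mul_inv_rev, inv_inv, map_mul]
  rw [h1, h2, mul_smul]

/-- **(S2b) (S-Y)-linearity.**  If `x = Σ_h c_h · hθ` (`x = λ·θ`, `λ = Σ c_h h ∈ A[G]` — e.g. the image
of `coord_θ(x) ∈ Λ_v` at level `m`), then `Res_φ(x) = φ̂(λ)·Res_φ(θ)` with `φ̂(λ) = Σ c_h φ(h) = ev_φ(λ)`. -/
theorem res_linear_combination (act : G →* (N →ₗ[A] N)) (φ : G →* A) (c : G → A) (θ : N) :
    res act φ (∑ h : G, c h • act h θ) = (∑ h : G, c h * φ h) • res act φ θ := by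
  rw [map_sum, Finset.sum_smul]
  refine Finset.sum_congr rfl (fun h _ => ?_)
  rw [map_smul, res_act, smul_smul]

/-- **(S2a) Δ-collapse, general form.**  For commuting actions of `G` and `D` the resolvent over
`G × D` at `φ ⊗ χ` is the `G`-resolvent at `φ` of the `D`-resolvent at `χ`. -/
theorem res_prod_collapse {D : Type*} [CommGroup D] [Fintype D]
    (act : G →* (N →ₗ[A] N)) (actD : D →* (N →ₗ[A] N)) (φ : G →* A) (χ : D →* A) (x : N) :
    ∑ p : G × D, (φ p.1⁻¹ * χ p.2⁻¹) • act p.1 (actD p.2 x)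
      = res act φ (∑ d : D, χ d⁻¹ • actD d x) := by
  rw [res_apply, Fintype.sum_prod_type]
  refine Finset.sum_congr rfl (fun g _ => ?_)
  rw [map_sum, Finset.smul_sum]
  refine Finset.sum_congr rfl (fun d _ => ?_)
  rw [map_smul, smul_smul]

/-- **(S2a) Δ-collapse, the case of record.**  `D = Gal(L_m/F_m) = {1, σ}`, `χ_u(σ) = −1`:
the `D`-resolvent is the INTEGRAL map `x ↦ x − σx` (no idempotent, no division by `2`: B61 (i)). -/
theorem sum_pair_char_neg {D : Type*} [CommGroup D] [Fintype D] [DecidableEq D]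
    (actD : D →* (N →ₗ[A] N)) (χ : D →* A) (σ : D) (hσ : σ ≠ 1)
    (huniv : (Finset.univ : Finset D) = {1, σ}) (hχ : χ σ = -1) (x : N) :
    ∑ d : D, χ d⁻¹ • actD d x = x - actD σ x := by
  have hσinv : σ⁻¹ = σ := by
    have hmem : σ⁻¹ ∈ (Finset.univ : Finset D) := Finset.mem_univ _
    rw [huniv, Finset.mem_insert, Finset.mem_singleton] at hmem
    rcases hmem with h | h
    · exact absurd (inv_eq_one.mp h) hσ
    · exact h
  rw [huniv, Finset.sum_pair (Ne.symm hσ), inv_one, map_one, map_one, hσinv, hχ, one_smul,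
    Module.End.one_apply, neg_one_smul, sub_eq_add_neg]

/-- **(S2c) Coherence along the tower (= trace-coherence of `θ`).**  For a surjection `π : G' ↠ G`
(`Gal(F_{m'}/ℚ₂) ↠ Gal(F_m/ℚ₂)`) with any set-theoretic section `s`, the resolvent of `θ'` at a
character INFLATED from `G` is the `G`-resolvent of the trace `Σ_{k ∈ ker π} kθ'` — so
`φ ↦ Res_φ(θ_{m(φ)})` is well defined on all finite-order `φ`, and `(Σ_g g(θ_m)·g⁻¹)_m` is a coherent
element `Θ` of `lim_m 𝒪̂[G_m] = 𝒪̂⟦Γ⟧` whenever `Tr θ_{m+1} = θ_m` ((S-Y)). -/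
theorem res_inflate {G' : Type*} [CommGroup G'] [Fintype G'] [DecidableEq G]
    (π : G' →* G) (s : G → G') (hs : ∀ g, π (s g) = g)
    (act' : G' →* (N →ₗ[A] N)) (φ : G →* A) (θ' : N) :
    res act' (φ.comp π) θ' =
      ∑ g : G, φ g⁻¹ • act' (s g) (∑ k ∈ Finset.univ.filter (fun k => π k = 1), act' k θ') := by
  rw [res_apply, ← Finset.sum_fiberwise Finset.univ π]
  refine Finset.sum_congr rfl (fun g _ => ?_)
  rw [map_sum, Finset.smul_sum]
  refine Finset.sum_nbij' (fun i => (s g)⁻¹ * i) (fun k => s g * k) ?_ ?_ ?_ ?_ ?_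
  · intro i hi
    rw [Finset.mem_filter] at hi ⊢
    refine ⟨Finset.mem_univ _, ?_⟩
    rw [map_mul, map_inv, hs, hi.2, inv_mul_cancel]
  · intro k hk
    rw [Finset.mem_filter] at hk ⊢
    refine ⟨Finset.mem_univ _, ?_⟩
    rw [map_mul, hs, hk.2, mul_one]
  · intro i _
    exact mul_inv_cancel_left (s g) i
  · intro k _
    exact inv_mul_cancel_left (s g) k
  · intro i hi
    rw [Finset.mem_filter] at hi
    have h1 : act' (s g) (act' ((s g)⁻¹ * i) θ') = act' i θ' := by
      rw [← Module.End.mul_apply, ← map_mul, mul_inv_cancel_left]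
    rw [h1, MonoidHom.comp_apply, map_inv, hi.2]

end Resolvent

/-! ## §2 (S3) The unit resolvent by congruence -/

section UnitResolvent

variable {B : Type*} [CommRing B]

/-- In residue characteristic `2` (`2 ∈ J(B)`), a `2`-power root of unity is `≡ 1 (mod J)`:
`(ζ − 1)^{2^k} ≡ ζ^{2^k} − 1 = 0` modulo every maximal ideal. -/
theorem sub_one_mem_jacobson_of_pow_two_pow_eq_one {ζ : B} {k : ℕ} (hζ : ζ ^ 2 ^ k = 1)
    (h2 : (2 : B) ∈ (⊥ : Ideal B).jacobson) : ζ - 1 ∈ (⊥ : Ideal B).jacobson := by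
  rw [Ideal.jacobson, Ideal.mem_sInf] at h2 ⊢
  intro 𝔪 h𝔪
  have hmax : 𝔪.IsMaximal := h𝔪.2
  have h2𝔪 : (2 : B) ∈ 𝔪 := h2 h𝔪
  -- freshman's dream modulo `𝔪`: `(ζ - 1)^(2^j) - (ζ^(2^j) - 1) ∈ 𝔪` for every `j`
  have dream : ∀ j : ℕ, (ζ - 1) ^ 2 ^ j - (ζ ^ 2 ^ j - 1) ∈ 𝔪 := by
    intro j
    induction j with
    | zero => simp
    | succ j ih =>
      have e1 : (ζ - 1) ^ 2 ^ (j + 1) - (ζ ^ 2 ^ (j + 1) - 1)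
          = ((ζ - 1) ^ 2 ^ j - (ζ ^ 2 ^ j - 1)) * ((ζ - 1) ^ 2 ^ j + (ζ ^ 2 ^ j - 1))
            - 2 * (ζ ^ 2 ^ j - 1) := by
        rw [pow_succ, pow_mul, pow_mul]; ring
      rw [e1]
      exact 𝔪.sub_mem (𝔪.mul_mem_right _ ih) (𝔪.mul_mem_right _ h2𝔪)
  have hpow : (ζ - 1) ^ 2 ^ k ∈ 𝔪 := by
    have := dream k
    rwa [hζ, sub_self, sub_zero] at this
  exact hmax.isPrime.mem_of_pow_mem _ hpow

/-- A character sum `Σ_g φ_g·a_g` with all `φ_g ≡ 1 (mod J)` and `Σ_g a_g` a unit is a unit. -/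
theorem isUnit_charSum_of_sub_one_mem_jacobson {ι : Type*} (s : Finset ι) (φ a : ι → B)
    (hφ : ∀ i ∈ s, φ i - 1 ∈ (⊥ : Ideal B).jacobson) (htr : IsUnit (∑ i ∈ s, a i)) :
    IsUnit (∑ i ∈ s, φ i * a i) := by
  obtain ⟨u, hu⟩ := htr
  have hmem : (∑ i ∈ s, φ i * a i) - ∑ i ∈ s, a i ∈ (⊥ : Ideal B).jacobson := by
    rw [← Finset.sum_sub_distrib]
    refine Ideal.sum_mem _ (fun i hi => ?_)
    have : φ i * a i - a i = a i * (φ i - 1) := by ring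
    rw [this]
    exact Ideal.mul_mem_left _ _ (hφ i hi)
  have hx : (∑ i ∈ s, φ i * a i) = ↑u * (↑u⁻¹ * ((∑ i ∈ s, φ i * a i) - ∑ i ∈ s, a i) + 1) := by
    rw [mul_add, ← mul_assoc, Units.mul_inv, one_mul, mul_one, ← hu]; ring
  rw [hx]
  refine (Units.isUnit u).mul (Ideal.isUnit_of_sub_one_mem_jacobson_bot _ ?_)
  rw [add_sub_cancel_right]
  exact Ideal.mul_mem_left _ _ hmem

/-- **(S3) The unit resolvent.**  `G` a finite `2`-group (`Gal(F_m/ℚ₂)`, cyclic of order `2^m`),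
residue characteristic `2`, `a g := g(θ_m)` with unit trace `Σ_g g(θ_m) = θ₀ ∈ ℤ₂ˣ` ((S-Y): the
coherent normal-basis generator projects onto a generator of `𝒪_{F_0} = ℤ₂`): then for EVERY
character `φ` of `G` the resolvent `Res_φ(θ_m) = Σ_g φ(g⁻¹)·g(θ_m)` is a unit. -/
theorem isUnit_res_values {G : Type*} [CommGroup G] [Fintype G] {k : ℕ}
    (hG : Fintype.card G = 2 ^ k) (h2 : (2 : B) ∈ (⊥ : Ideal B).jacobson)
    (φ : G →* B) (a : G → B) (htr : IsUnit (∑ g : G, a g)) :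
    IsUnit (∑ g : G, φ g⁻¹ * a g) := by
  refine isUnit_charSum_of_sub_one_mem_jacobson Finset.univ (fun g => φ g⁻¹) a (fun g _ => ?_) htr
  refine sub_one_mem_jacobson_of_pow_two_pow_eq_one (k := k) ?_ h2
  rw [← map_pow, ← hG, pow_card_eq_one, map_one]

/-- **(S3, series form) unit augmentation ⟹ unit values, out of range included.**  The coherent
`Θ = (Σ_g g(θ_m) g⁻¹)_m`, read in `𝒪̂⟦T⟧ ≅ 𝒪̂⟦Γ⟧`, has constant coefficient (augmentation) `θ₀`, a
unit; so `Θ` is a unit and so is its image under ANY ring map — in particular `ρ^{ur}(Θ)` for the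
infinite-order unramified part `ρ^{ur}` of `ρ_v`. -/
theorem isUnit_map_of_isUnit_constantCoeff {R S : Type*} [CommRing R] [CommRing S]
    (f : PowerSeries R →+* S) (Θ : PowerSeries R) (h : IsUnit (PowerSeries.constantCoeff Θ)) :
    IsUnit (f Θ) :=
  (PowerSeries.isUnit_iff_constantCoeff.mpr h).map f

end UnitResolvent

/-! ## §3 (S4) GAUSS = TWIST: the three Gauss sums of the inertia types, and the key table -/

section Gauss

variable {R : Type*} [CommRing R]

/-- Kronecker-symbol tables of the three inertia types `θ_e` (rows of record: `χ₋₄` for the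
conductor-`4` keys `u ∈ {−1, 3}`, `χ₈` for `u ∈ {2, −6}`, `χ₋₈ = χ₈'` for `u ∈ {−2, 6}`). -/
def chi4Tab : Fin 4 → ℤ := ![0, 1, 0, -1]
def chi8Tab : Fin 8 → ℤ := ![0, 1, 0, -1, 0, -1, 0, 1]
def chi8'Tab : Fin 8 → ℤ := ![0, 1, 0, 1, 0, -1, 0, -1]

/-- The tables ARE Mathlib's quadratic characters `ZMod.χ₄`, `ZMod.χ₈`, `ZMod.χ₈'`. -/
theorem chi4_table : ∀ a : ZMod 4, ZMod.χ₄ a = chi4Tab a := by decide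
theorem chi8_table : ∀ a : ZMod 8, ZMod.χ₈ a = chi8Tab a := by decide
theorem chi8'_table : ∀ a : ZMod 8, ZMod.χ₈' a = chi8'Tab a := by decide

/-- Gauss sums `g(θ) = Σ_{a mod 2^e} θ(a) ζ^a` at a primitive `2^e`-th root of unity `ζ`. -/
def gauss4 (ζ : R) : R := ∑ a : Fin 4, (chi4Tab a : R) * ζ ^ (a : ℕ)
def gauss8 (ζ : R) : R := ∑ a : Fin 8, (chi8Tab a : R) * ζ ^ (a : ℕ)
def gauss8' (ζ : R) : R := ∑ a : Fin 8, (chi8'Tab a : R) * ζ ^ (a : ℕ)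

/-- `g(χ₋₄) = ζ − ζ³ = 2ζ = 2i` (Fröhlich–Taylor (3.5.a)). -/
theorem gauss4_eq (ζ : R) (hζ : ζ ^ 2 = -1) : gauss4 ζ = 2 * ζ := by
  simp [gauss4, chi4Tab, Fin.sum_univ_four]
  linear_combination (-ζ) * hζ

theorem gauss4_sq (ζ : R) (hζ : ζ ^ 2 = -1) : gauss4 ζ ^ 2 = 4 * (-1) := by
  rw [gauss4_eq ζ hζ]; linear_combination 4 * hζ

/-- `g(χ₈) = ζ − ζ³ − ζ⁵ + ζ⁷ = 2(ζ − ζ³)` with `(ζ − ζ³)² = 2`: `g(χ₈) = 2√2` (F–T (3.5.b)). -/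
theorem gauss8_eq (ζ : R) (hζ : ζ ^ 4 = -1) : gauss8 ζ = 2 * (ζ - ζ ^ 3) := by
  simp [gauss8, chi8Tab, Fin.sum_univ_eight]
  linear_combination (ζ ^ 3 - ζ) * hζ

theorem sqrt_two_sq (ζ : R) (hζ : ζ ^ 4 = -1) : (ζ - ζ ^ 3) ^ 2 = 2 := by
  linear_combination (ζ ^ 2 - 2) * hζ

theorem gauss8_sq (ζ : R) (hζ : ζ ^ 4 = -1) : gauss8 ζ ^ 2 = 4 * 2 := by
  rw [gauss8_eq ζ hζ, mul_pow, sqrt_two_sq ζ hζ]; norm_num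

/-- `g(χ₋₈) = ζ + ζ³ − ζ⁵ − ζ⁷ = 2(ζ + ζ³)` with `(ζ + ζ³)² = −2`: `g(χ₋₈) = 2i√2` (F–T (3.5.c)). -/
theorem gauss8'_eq (ζ : R) (hζ : ζ ^ 4 = -1) : gauss8' ζ = 2 * (ζ + ζ ^ 3) := by
  simp [gauss8', chi8'Tab, Fin.sum_univ_eight]
  linear_combination (-(ζ + ζ ^ 3)) * hζ

theorem sqrt_neg_two_sq (ζ : R) (hζ : ζ ^ 4 = -1) : (ζ + ζ ^ 3) ^ 2 = -2 := by
  linear_combination (ζ ^ 2 + 2) * hζ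

theorem gauss8'_sq (ζ : R) (hζ : ζ ^ 4 = -1) : gauss8' ζ ^ 2 = 4 * (-2) := by
  rw [gauss8'_eq ζ hζ, mul_pow, sqrt_neg_two_sq ζ hζ]; norm_num

/-- A key of record: `u` (so `K_key,v = ℚ₂(√u)`), the `v`-level `e = n(key)` (conductor `2^e`),
the discriminant type `u₀ ∈ {−1, 2, −2}` of its inertia character `θ_e` (`g(θ_e)² = 4u₀`), and the
B52 bit `c` (`u = u₀·(−3)^c`: the unramified quadratic twist). -/
structure KeyRow where
  u : ℤ
  e : ℕ
  u₀ : ℤ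
  c : ℕ

/-- The six keys `(u, e, u₀, c)`. -/
def keys : List KeyRow :=
  [⟨-1, 2, -1, 0⟩, ⟨3, 2, -1, 1⟩, ⟨2, 3, 2, 0⟩, ⟨-6, 3, 2, 1⟩, ⟨-2, 3, -2, 0⟩, ⟨6, 3, -2, 1⟩]

/-- The key table: `u = u₀(−3)^c` (GAUSS = TWIST: `√u = √u₀ · (√−3)^c`), `16u₀² = 4^e`
(the torsion average `2^{−e}` against `g(θ_e)·2 = 4√u₀`), `e ∈ {2, 3}`. -/
theorem keys_table : ∀ r ∈ keys, r.u = r.u₀ * (-3) ^ r.c ∧ r.u₀ ^ 2 * 16 = 4 ^ r.e ∧ 1 ≤ r.e := by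
  decide

/-- **The exact constant.**  `υ := τ_dS(θ_e)·(2√u) = (g/2^e)·(2r)` with `g² = 4u₀` (Gauss),
`r² = u = u₀(−3)^c` (the key) and `16u₀² = 4^e` (the table) satisfies `υ² = (−3)^c`. -/
theorem exactConstant_sq {𝕜 : Type*} [Field 𝕜] (g r : 𝕜) (u₀ : ℤ) (e c : ℕ) (h2 : (2 : 𝕜) ≠ 0)
    (hg : g ^ 2 = 4 * u₀) (hr : r ^ 2 = u₀ * (-3) ^ c) (hu : (u₀ : 𝕜) ^ 2 * 16 = 4 ^ e) :
    (g / 2 ^ e * (2 * r)) ^ 2 = (-3) ^ c := by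
  have h2e : (2 : 𝕜) ^ e ≠ 0 := pow_ne_zero _ h2
  have h4 : ((2 : 𝕜) ^ e) ^ 2 = 4 ^ e := by
    rw [← pow_mul, mul_comm, pow_mul]; norm_num
  rw [div_mul_eq_mul_div, div_pow, div_eq_iff (pow_ne_zero _ h2e), h4]
  linear_combination (4 * r ^ 2) * hg + (16 * (u₀ : 𝕜)) * hr + (-3 : 𝕜) ^ c * hu

/-- `−3` is the square of the unit `1 + 2ζ₃` of `𝕎(𝔽₄) = ℤ₂[ζ₃]` (`ζ₃² + ζ₃ + 1 = 0`). -/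
theorem neg_three_eq_sq (ζ₃ : R) (h : ζ₃ ^ 2 + ζ₃ + 1 = 0) : (1 + 2 * ζ₃) ^ 2 = -3 := by
  linear_combination 4 * h

/-- Hence `υ ∈ {±1}` on the `c = 0` keys and `υ ∈ {±(1 + 2ζ₃)}` on the `c = 1` keys. -/
theorem exactConstant_mem {𝕜 : Type*} [Field 𝕜] (υ ζ₃ : 𝕜) (h : ζ₃ ^ 2 + ζ₃ + 1 = 0) (c : ℕ)
    (hc : c = 0 ∨ c = 1) (hυ : υ ^ 2 = (-3) ^ c) :
    υ = 1 ∨ υ = -1 ∨ υ = 1 + 2 * ζ₃ ∨ υ = -(1 + 2 * ζ₃) := by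
  rcases hc with rfl | rfl
  · rw [pow_zero, ← one_pow 2] at hυ
    rcases sq_eq_sq_iff_eq_or_eq_neg.mp hυ with h1 | h1
    · exact Or.inl h1
    · exact Or.inr (Or.inl h1)
  · rw [pow_one, ← neg_three_eq_sq ζ₃ h] at hυ
    rcases sq_eq_sq_iff_eq_or_eq_neg.mp hυ with h1 | h1
    · exact Or.inr (Or.inr (Or.inl h1))
    · exact Or.inr (Or.inr (Or.inr h1))

/-- **(S4, valuation form)** for any valuation trivial on `3` (residue characteristic `2`):
`v(υ) = 1` — the data-leg constant of R197a′ carries NO digit, on all six keys. -/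
theorem valuation_exactConstant {𝕜 : Type*} [Field 𝕜] {Γ₀ : Type*}
    [LinearOrderedCommGroupWithZero Γ₀] (v : Valuation 𝕜 Γ₀) (hv3 : v 3 = 1)
    (υ : 𝕜) (c : ℕ) (hυ : υ ^ 2 = (-3) ^ c) : v υ = 1 := by
  have h : v υ ^ 2 = 1 := by
    rw [← map_pow, hυ, map_pow, Valuation.map_neg, hv3, one_pow]
  exact (pow_eq_one_iff_left two_ne_zero).mp h

end Gauss

/-! ## §4 GLUE: the four sub-stubs compose to the exact-constant value identity and its consumed forms -/

section Glue

variable {𝕜 : Type*} [Field 𝕜] {Φ : Type*}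

/-- The value tables at `v` on the `χ_u`-line, indexed by the finite-order characters `φ` of the
unramified direction (level `m(φ)`), for ONE norm-coherent semi-local unit `β` (of record:
`β = σ_𝔮 e_{e,m}(𝔞)` at the component `w₀ ∣ v`; the Shapiro sum over `w ∣ v` is R216 / k3-g36). -/
structure LocalValueTables (Φ : Type*) (𝕜 : Type*) where
  /-- `φ ↦ ∫ φχ_u dμ_β⁰` (de Shalit's measure of `β`, II.4.6–4.8). -/
  I : Φ → 𝕜
  /-- `φ ↦ Res_{φ⊗χ_u}(log β_{e,m(φ)})⁰` (the log-resolvent over `Gal(𝓛_m/ℚ₂) = G_m × (ℤ/2^e)ˣ`). -/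
  Rlog : Φ → 𝕜
  /-- `φ ↦ ev_φ(coord_θ(g_u y_β))`, `y_β = (N_{𝓛_m/L_m} β_m)^{1−σ} ∈ S_m`, `g_u = log₂/(2√u) : M → Y`. -/
  E : Φ → 𝕜
  /-- `φ ↦ Res_φ(θ_{m(φ)})`, `θ` the (S-Y) trace-coherent normal-basis generator. -/
  Rθ : Φ → 𝕜
  /-- `φ ↦ ev_φ(L y_β)`, `L = Lg_u = (2w)·g_u` (R206/B48). -/
  EL : Φ → 𝕜
  /-- `φ ↦ φ̂(w)`, `w ∈ Λ_vˣ` the unit of R206. -/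
  W : Φ → 𝕜
  /-- de Shalit's `τ(θ_e) = 2^{−e} g(θ_e)` (II.4.8 (19)). -/
  τ : 𝕜
  /-- `2√u` (the gauge: `log₂ y = 2√u · g_u(y)`). -/
  s : 𝕜

/-- **S1** (PRINT: de Shalit II.4.8 (21) at `k = 0`, `𝔭 := v`, `n = e`; `p = 2` allowed). -/
def S1 (T : LocalValueTables Φ 𝕜) : Prop := ∀ φ, T.I φ = T.τ * T.Rlog φ

/-- **S2** (KERNEL §1: Δ-collapse + (S-Y)-linearity): `Res_{φ⊗χ_u}(log β) = Res_φ(log y_β) =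
2√u · ev_φ(coord g_u(y_β)) · Res_φ(θ_m)`. -/
def S2 (T : LocalValueTables Φ 𝕜) : Prop := ∀ φ, T.Rlog φ = T.s * (T.E φ * T.Rθ φ)

/-- **S3** (KERNEL §2: unit resolvent), read through a valuation `v`. -/
def S3 {Γ₀ : Type*} [LinearOrderedCommGroupWithZero Γ₀] (v : Valuation 𝕜 Γ₀)
    (T : LocalValueTables Φ 𝕜) : Prop := ∀ φ, v (T.Rθ φ) = 1

/-- **S4** (KERNEL §3: GAUSS = TWIST): `(τ·2√u)² = (−3)^c`. -/
def S4 (T : LocalValueTables Φ 𝕜) (c : ℕ) : Prop := (T.τ * T.s) ^ 2 = (-3) ^ c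

/-- The `L`-gauge dictionary (R206/B48: `L = (2w)·g_u`, `w` a unit). -/
def LGauge {Γ₀ : Type*} [LinearOrderedCommGroupWithZero Γ₀] (v : Valuation 𝕜 Γ₀)
    (T : LocalValueTables Φ 𝕜) : Prop := ∀ φ, T.EL φ = 2 * T.W φ * T.E φ ∧ v (T.W φ) = 1

/-- **GLUE 1: the value identity with its exact constant** `υ = τ·2√u`:
`∫ φχ_u dμ_β⁰ = υ · Res_φ(θ_m) · ev_φ(coord g_u(y_β))`. -/
theorem value_identity (T : LocalValueTables Φ 𝕜) (h1 : S1 T) (h2 : S2 T) (φ : Φ) :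
    T.I φ = (T.τ * T.s) * T.Rθ φ * T.E φ := by
  rw [h1 φ, h2 φ]; ring

/-- **GLUE 2: the constant is a unit** (`v(υ · Res_φ(θ_m)) = 1`). -/
theorem valuation_constant {Γ₀ : Type*} [LinearOrderedCommGroupWithZero Γ₀] (v : Valuation 𝕜 Γ₀)
    (hv3 : v 3 = 1) (T : LocalValueTables Φ 𝕜) {c : ℕ} (h3 : S3 v T) (h4 : S4 T c) (φ : Φ) :
    v ((T.τ * T.s) * T.Rθ φ) = 1 := by
  rw [map_mul, valuation_exactConstant v hv3 _ c h4, h3 φ, one_mul]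

/-- **GLUE 3 = K2's consumed form in the `g`-gauge**: the measure value and the `g`-coordinate value
have THE SAME valuation at every finite-order `φ`, on all six keys. -/
theorem consumed_form_g {Γ₀ : Type*} [LinearOrderedCommGroupWithZero Γ₀] (v : Valuation 𝕜 Γ₀)
    (hv3 : v 3 = 1) (T : LocalValueTables Φ 𝕜) {c : ℕ} (h1 : S1 T) (h2 : S2 T) (h3 : S3 v T)
    (h4 : S4 T c) (φ : Φ) : v (T.I φ) = v (T.E φ) := by
  rw [value_identity T h1 h2 φ, map_mul, valuation_constant v hv3 T h3 h4 φ, one_mul]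

/-- **GLUE 4 = the consumed form in the `L`-gauge**: `v(ev_φ(L y_β)) = v(2) · v(∫ φχ_u dμ_β⁰)` —
the located `2` of `L = (2w)·g` is the ONLY non-unit between the `L`-value and the measure value. -/
theorem consumed_form_L {Γ₀ : Type*} [LinearOrderedCommGroupWithZero Γ₀] (v : Valuation 𝕜 Γ₀)
    (hv3 : v 3 = 1) (T : LocalValueTables Φ 𝕜) {c : ℕ} (h1 : S1 T) (h2 : S2 T) (h3 : S3 v T)
    (h4 : S4 T c) (hL : LGauge v T) (φ : Φ) : v (T.EL φ) = v 2 * v (T.I φ) := by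
  rw [(hL φ).1, map_mul, map_mul, (hL φ).2, mul_one, consumed_form_g v hv3 T h1 h2 h3 h4 φ]

/-- **GLUE 5: transport out of range by separation.**  If the finite-order evaluations `ev φ`
SEPARATE the measure algebra `Λ` (`𝒪̂⟦Γ⟧`; tree `IntSeriesIdentityPrinciple`, k3-g29
`CharactersSeparate`, k1-g35 `Separates`) and the three tables are the values of elements
`μ, Θ, a ∈ Λ` (`μ` = the `χ_u`-branch of `μ_β⁰`, `Θ` the resolvent series, `a = coord_θ g_u(y_β)`),
then `μ = υ·Θ·a` IN `Λ`, hence the identity holds at EVERY evaluation `Ψ` — e.g. `Ψ = ∫ρ_v d(−)` with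
`ρ^{ur}` of infinite order. -/
theorem transport_of_separates {O Λ : Type*} [CommRing O] [CommRing Λ] [Algebra O Λ] [Algebra O 𝕜]
    (ev : Φ → (Λ →ₐ[O] 𝕜)) (hsep : ∀ x y : Λ, (∀ φ, ev φ x = ev φ y) → x = y)
    (υ : O) (μ Θ a : Λ) (hval : ∀ φ, ev φ μ = algebraMap O 𝕜 υ * ev φ Θ * ev φ a)
    (Ψ : Λ →ₐ[O] 𝕜) : Ψ μ = algebraMap O 𝕜 υ * Ψ Θ * Ψ a := by
  have hμ : μ = υ • (Θ * a) := by
    refine hsep _ _ (fun φ => ?_)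
    rw [hval φ, map_smul, map_mul, Algebra.smul_def, mul_assoc]
  rw [hμ, map_smul, map_mul, Algebra.smul_def, mul_assoc]

/-- … and the transported constant `υ·Ψ(Θ)` is a unit as soon as `υ` and `Θ` are
(§3 `exactConstant_mem`, §2 `isUnit_map_of_isUnit_constantCoeff`). -/
theorem isUnit_transport_constant {O Λ : Type*} [CommRing O] [CommRing Λ] [Algebra O Λ]
    [Algebra O 𝕜] (υ : O) (Θ : Λ) (hυ : IsUnit υ) (hΘ : IsUnit Θ) (Ψ : Λ →ₐ[O] 𝕜) :
    IsUnit (algebraMap O 𝕜 υ * Ψ Θ) :=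
  (hυ.map (algebraMap O 𝕜)).mul (hΘ.map Ψ)

end Glue

end Summit.BirchSwinnertonDyer.BirchSwinnertonDyer.Cruxes.SplitBadTwoLowerHalfOfFacts.GaussTwistK3G37
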